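import Summits.HodgeConjecture.CorCM.MumfordTateRankQuaternionLefschetzDimension
import Summits.HodgeConjecture.CorCM.MumfordTateRankOfPowers
import Literature.AlgebraicGeometry.HodgeTheory.TypeIIMinimalMumfordTateRank
import Literature.AlgebraicGeometry.HodgeTheory.QuaternionMinimalPowersHodgeClasses
import HarnessLib

/-!
# Type II minimal (`m = 1`, any totally real centre): `dim MT(H¹B) = 3e + 1` and `Lie Hg(H¹B) = C(End⁰B) ∩ 𝔰𝔭(H¹B, ψ)` —
# Hodge = Lefschetz for every simple abelian variety of dimension `2e` with quaternion multiplication over a totally real field of degree `e`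

COR-CM (cell `pub-hodgecm2`, seat `b27` gen 46, count-neutral Mumford–Tate-rank ladder; theorems only, no definition, no named
fact; UNCONDITIONAL — nothing here uses or asserts HC_CM).  Sequel of `CorCM/MumfordTateRankQuaternionLefschetzDimension` (type
II(e): the Lefschetz Lie algebra `C(End_Hdg) ∩ 𝔰𝔭(ψ)` has dimension `e · m(2m+1)` and `Lie Hg` equals it iff `dim Lie Hg = e · m(2m+1)`)
at `m = 1`, where the Literature count `HodgeTheory/TypeIIMinimalMumfordTateRank` (`dim Lie Hg(H¹B) = 3e`: the glued-`𝔰𝔩₂`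
description of `Lie Hg ⊗ ℂ` — Moonen–Zarhin (2.2) «`Hg = U_{D^opp}`», Banaszak–Gajda–Krasoń (7.22) `H(A) = L(A)`, Murty Thm. 2 for
`m = 1` — has exactly `e` classes, one per infinite place of the centre) supplies the right-hand side.  This generalises two rungs
already on the ladder: QM abelian SURFACES (`e = 1`, `t = 4`, `CorCM/MumfordTateRankSimpleSurfaces`) and the `(2,2,2)` FOURFOLDS
(`e = 2`, `t = 7`, `CorCM/MumfordTateRankQuaternionLefschetzDimension` §3), to every degree `e`.

* **`mtRank_hodge_one_of_isSimple_typeTwo_minimal`** — `B` simple, `End⁰B` a quaternion algebra over a totally real number field `K`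
  of degree `e`, split at every infinite place of `K`, `dim B = 2e` ⟹ **`dim MT(H¹B) = 3e + 1`**, `dim Lie Hg(H¹B) = 3e`.
* **`hodgeLie_hodge_one_eq_lefschetz_of_isSimple_typeTwo_minimal`** — then **`Lie Hg(H¹B) = C(End_Hdg(H¹B)) ∩ 𝔰𝔭(H¹B, ψ)`** for
  every polarization `ψ`: HODGE = LEFSCHETZ at the level of Lie algebras (B–G–K (7.22); Murty Thm. 2).
* **`mtRank_hodge_one_of_isSimple_quaternion_of_dim_eq`**, **`hodgeLie_hodge_one_eq_lefschetz_of_isSimple_quaternion_of_dim_eq`**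
  — the SPLITTING-FREE form: `B` simple, `End⁰B` ANY quaternion algebra over a totally real `K` of degree `e`, `dim B = 2e` ⟹
  `dim MT(H¹B) = 3e + 1` and Hodge = Lefschetz, because type III with `m = 1` does not occur (Shimura 1963 §4; the tree's
  `AbelianVariety.isTotallyIndefinite_of_isSimple_of_dim_eq`, `HodgeTheory/QuaternionMinimalPowersHodgeClasses`); and the «no factor
  of type IV» form over an arbitrary number field `K` (`…_of_hasNoTypeIVFactor`, `K` is then totally real).
* **`mtRank_hodge_one_of_isIsogenous_powSucc_quaternion_of_dim_eq`** — every `X ∼ B^{n+1}` has `dim MT(H¹X) = 3e + 1` (the rank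
  of a power is the rank of the factor, `CorCM/MumfordTateRankOfPowers`).
* **`mtRank_hodge_one_of_isSimple_quaternion_sixfold_cubic`** — the atlas rows II(3) ∪ «III(3), `m = 1`»: a simple abelian SIXFOLD
  with quaternion multiplication over a totally real CUBIC field has `dim MT(H¹B) = 10` and Hodge = Lefschetz.

## References
* [MoonenZarhin1999LowDim] B. Moonen, Yu. G. Zarhin, Math. Ann. 315 (1999), (2.2) Type 2(1) («`Hg = U_{D^opp}`»), §3 (3.1).
* [BanaszakGajdaKrason2006] G. Banaszak, W. Gajda, P. Krasoń, Doc. Math. Extra Vol. Coates (2006), p. 36, Cor. 7.19 (7.22)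
  («`H(A) = L(A) = C_D(Sp(V, ψ))`»), Thm. 7.34.
* [Murty1988] V. Kumar Murty, Proc. AMS 104 (1988), Thm. 2 (p. 67) («`Hod(A) = L(A)`», `m = 1`).
* [Milne1999LefschetzClasses] J. S. Milne, Duke Math. J. 96 (1999), §2 (type II: `dim = g²/2f + g/2`) and Summary.
* [MumfordAV1970] D. Mumford, *Abelian Varieties* (1970), §21 Thm. 2 (type II).
* [Shimura1963AnalyticFamilies] G. Shimura, Ann. of Math. 78 (1963), §4 (type III with `m = 1` does not occur).
* [Lange2023AbelianVarietiesComplex] H. Lange, *Abelian Varieties over the Complex Numbers* (2023), §2.6.2 Thm. 2.6.5 (b), (c).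
-/

noncomputable section

open scoped TensorProduct
open CategoryTheory CategoryTheory.Limits Module NumberField

namespace Summit.HodgeConjecture.CorCM

open Literature.AlgebraicGeometry.Motives
open Literature.AlgebraicGeometry.Motives.AbelianVariety
open Literature.AlgebraicGeometry.Motives.HodgeStructure
open Literature.AlgebraicGeometry.HodgeTheory
open Literature.NumberTheory.Automorphic (IsQuaternionAlgebra)
open Literature.RingTheory.CentralSimple

variable [HodgeTensorFacts.{0, 0}]

/-! ## §1 The rung `t = 3e + 1`: type II with `m = 1` -/

/-- **Type II minimal: `dim MT(H¹B) = 3e + 1` and `dim Lie Hg(H¹B) = 3e`** for a simple complex abelian variety `B` whose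
endomorphism algebra is a quaternion algebra over a totally real number field `K` of degree `e`, split at every infinite place of
`K`, with `dim B = 2e` (Moonen–Zarhin (2.2) «`Hg = U_{D^opp}`»; Banaszak–Gajda–Krasoń (7.22) `H(A) = L(A) = C_D(Sp)`, of dimension
`3e`; Murty Thm. 2, `m = 1`) — the Literature count `mtRank_hodge_one_of_isSimple_isTotallyIndefinite'`.
[cite: MoonenZarhin1999LowDim, (2.2)] [cite: BanaszakGajdaKrason2006, (7.22) and Thm. 7.34] [cite: Murty1988, Thm. 2 (p. 67)] -/
theorem mtRank_hodge_one_of_isSimple_typeTwo_minimal {B : AbelianVariety ℂ} {k : ℕ} (hB : IsSmoothProjective k B.X)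
    (hBs : B.IsSimple) {K : Type} [Field K] [NumberField K] [IsTotallyReal K] [Algebra K B.endAlgebra]
    [IsScalarTower ℚ K B.endAlgebra] [IsQuaternionAlgebra K B.endAlgebra] (hind : IsTotallyIndefinite K B.endAlgebra)
    (hBK : B.dim = 2 * Module.finrank ℚ K) :
    haveI := BettiUniverse.finite hB 1
    (BettiUniverse.hodge exists_isReal_hodgeModel_holds hB 1).mtRank = 3 * Module.finrank ℚ K + 1 ∧
      Module.finrank ℚ (BettiUniverse.hodge exists_isReal_hodgeModel_holds hB 1).hodgeLie = 3 * Module.finrank ℚ K :=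
  mtRank_hodge_one_of_isSimple_isTotallyIndefinite' hB hBs hind hBK

/-- **Hodge = Lefschetz for type II minimal**: under the same hypotheses `Lie Hg(H¹B) = C(End_Hdg(H¹B)) ∩ 𝔰𝔭(H¹B, ψ)` for EVERY
polarization `ψ` of `H¹B` — both sides have dimension `3e = e · m(2m+1)` at `m = 1` (the criterion
`hodgeLie_hodge_one_eq_lefschetz_iff_of_isTotallyIndefinite_centre` of `CorCM/MumfordTateRankQuaternionLefschetzDimension`).
Banaszak–Gajda–Krasoń (7.22) «`H(A) = L(A)`», Murty Thm. 2 «`Hod(A) = L(A)`», at the level of Lie algebras.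
[cite: BanaszakGajdaKrason2006, (7.22)] [cite: Murty1988, Thm. 2 (p. 67)] [cite: Milne1999LefschetzClasses, §2] -/
theorem hodgeLie_hodge_one_eq_lefschetz_of_isSimple_typeTwo_minimal {B : AbelianVariety ℂ} {k : ℕ} (hB : IsSmoothProjective k B.X)
    (hBs : B.IsSimple) {K : Type} [Field K] [NumberField K] [IsTotallyReal K] [Algebra K B.endAlgebra]
    [IsScalarTower ℚ K B.endAlgebra] [IsQuaternionAlgebra K B.endAlgebra] (hind : IsTotallyIndefinite K B.endAlgebra)
    (hBK : B.dim = 2 * Module.finrank ℚ K) [Module.Finite ℚ (bettiCohomology B.X 1)]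
    (ψ : (BettiUniverse.hodge exists_isReal_hodgeModel_holds hB 1).Polarization) :
    (BettiUniverse.hodge exists_isReal_hodgeModel_holds hB 1).hodgeLie = Subalgebra.toSubmodule (Subalgebra.centralizer ℚ
        ((BettiUniverse.hodge exists_isReal_hodgeModel_holds hB 1).endAlg : Set (Module.End ℚ (bettiCohomology B.X 1)))) ⊓
      ψ.form.skewAdjointSubmodule := by
  have h := (mtRank_hodge_one_of_isSimple_typeTwo_minimal hB hBs hind hBK).2
  refine (hodgeLie_hodge_one_eq_lefschetz_iff_of_isTotallyIndefinite_centre hB hBs hind (m := 1) (by omega) ψ).2 ?_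
  rw [h]
  ring

/-! ## §2 The splitting-free form: any quaternion algebra over a totally real field of degree `dim B / 2` -/

/-- **`dim MT(H¹B) = 3e + 1` and `dim Lie Hg(H¹B) = 3e` for EVERY simple abelian variety of dimension `2e` whose endomorphism
algebra is a quaternion algebra over a totally real field of degree `e`** — no hypothesis on the infinite places: type III with
`m = 1` does not occur (Shimura 1963 §4; the tree's `AbelianVariety.isTotallyIndefinite_of_isSimple_of_dim_eq`: the Rosati involution
is positive of the first kind, Albert leaves types II/III, and III is excluded), so §1 applies.
[cite: Shimura1963AnalyticFamilies, §4] [cite: Lange2023AbelianVarietiesComplex, §2.6.2 Thm. 2.6.5 (b), (c)]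
[cite: BanaszakGajdaKrason2006, (7.22) and Thm. 7.34] [cite: Murty1988, Thm. 2 (p. 67)] -/
theorem mtRank_hodge_one_of_isSimple_quaternion_of_dim_eq {B : AbelianVariety ℂ} {k : ℕ} (hB : IsSmoothProjective k B.X)
    (hBs : B.IsSimple) {K : Type} [Field K] [NumberField K] [IsTotallyReal K] [Algebra K B.endAlgebra]
    [IsScalarTower ℚ K B.endAlgebra] [IsQuaternionAlgebra K B.endAlgebra] (hBK : B.dim = 2 * Module.finrank ℚ K) :
    haveI := BettiUniverse.finite hB 1
    (BettiUniverse.hodge exists_isReal_hodgeModel_holds hB 1).mtRank = 3 * Module.finrank ℚ K + 1 ∧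
      Module.finrank ℚ (BettiUniverse.hodge exists_isReal_hodgeModel_holds hB 1).hodgeLie = 3 * Module.finrank ℚ K :=
  mtRank_hodge_one_of_isSimple_typeTwo_minimal hB hBs (AbelianVariety.isTotallyIndefinite_of_isSimple_of_dim_eq hBs hBK) hBK

/-- **Hodge = Lefschetz for EVERY simple abelian variety of dimension `2e` with quaternion multiplication over a totally real field
of degree `e`**: `Lie Hg(H¹B) = C(End_Hdg(H¹B)) ∩ 𝔰𝔭(H¹B, ψ)` for every polarization `ψ` (splitting-free form of §1).
[cite: BanaszakGajdaKrason2006, (7.22)] [cite: Murty1988, Thm. 2 (p. 67)] [cite: Shimura1963AnalyticFamilies, §4] -/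
theorem hodgeLie_hodge_one_eq_lefschetz_of_isSimple_quaternion_of_dim_eq {B : AbelianVariety ℂ} {k : ℕ}
    (hB : IsSmoothProjective k B.X) (hBs : B.IsSimple) {K : Type} [Field K] [NumberField K] [IsTotallyReal K]
    [Algebra K B.endAlgebra] [IsScalarTower ℚ K B.endAlgebra] [IsQuaternionAlgebra K B.endAlgebra]
    (hBK : B.dim = 2 * Module.finrank ℚ K) [Module.Finite ℚ (bettiCohomology B.X 1)]
    (ψ : (BettiUniverse.hodge exists_isReal_hodgeModel_holds hB 1).Polarization) :
    (BettiUniverse.hodge exists_isReal_hodgeModel_holds hB 1).hodgeLie = Subalgebra.toSubmodule (Subalgebra.centralizer ℚ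
        ((BettiUniverse.hodge exists_isReal_hodgeModel_holds hB 1).endAlg : Set (Module.End ℚ (bettiCohomology B.X 1)))) ⊓
      ψ.form.skewAdjointSubmodule :=
  hodgeLie_hodge_one_eq_lefschetz_of_isSimple_typeTwo_minimal hB hBs (AbelianVariety.isTotallyIndefinite_of_isSimple_of_dim_eq hBs hBK)
    hBK ψ

/-- **The «no factor of type IV» form over an arbitrary number field**: `B` simple, `End⁰B` a quaternion algebra over a number field
`K` with no factor of type IV (totally real centre) and `dim B = 2[K:ℚ]` ⟹ `dim MT(H¹B) = 3[K:ℚ] + 1` and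
`dim Lie Hg(H¹B) = 3[K:ℚ]` (`K` is then totally real and `End⁰B` totally indefinite, the tree's
`AbelianVariety.isTotallyIndefinite_of_isSimple_of_hasNoTypeIVFactor_of_dim_eq`). [cite: Shimura1963AnalyticFamilies, §4]
[cite: Lange2023AbelianVarietiesComplex, §2.6.2 Thm. 2.6.5 (b), (c)] [cite: Murty1988, Thm. 2 (p. 67)] -/
theorem mtRank_hodge_one_of_isSimple_quaternion_of_hasNoTypeIVFactor {B : AbelianVariety ℂ} {k : ℕ}
    (hB : IsSmoothProjective k B.X) (hBs : B.IsSimple) (hIV : HasNoTypeIVFactor B) {K : Type} [Field K] [NumberField K]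
    [Algebra K B.endAlgebra] [IsScalarTower ℚ K B.endAlgebra] [IsQuaternionAlgebra K B.endAlgebra]
    (hBK : B.dim = 2 * Module.finrank ℚ K) :
    haveI := BettiUniverse.finite hB 1
    (BettiUniverse.hodge exists_isReal_hodgeModel_holds hB 1).mtRank = 3 * Module.finrank ℚ K + 1 ∧
      Module.finrank ℚ (BettiUniverse.hodge exists_isReal_hodgeModel_holds hB 1).hodgeLie = 3 * Module.finrank ℚ K := by
  obtain ⟨hK, hind⟩ := AbelianVariety.isTotallyIndefinite_of_isSimple_of_hasNoTypeIVFactor_of_dim_eq hBs hIV hBK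
  exact mtRank_hodge_one_of_isSimple_typeTwo_minimal hB hBs hind hBK

/-- **Every `X ∼ B^{n+1}` over a simple `B` of dimension `2e` with quaternion multiplication over a totally real field of degree
`e` has `dim MT(H¹X) = 3e + 1`** (the Mumford–Tate rank of a power is that of the factor, `mtRank_hodge_one_eq_of_isIsogenous_powSucc`;
Murty Thm. 2: `𝓑(Aᵏ) = 𝓓(Aᵏ)` for all `k`). [cite: Murty1988, Thm. 2 (p. 67)] [cite: MoonenZarhin1999LowDim, (2.2) and §3 (3.1)] -/
theorem mtRank_hodge_one_of_isIsogenous_powSucc_quaternion_of_dim_eq {X : AbelianVariety ℂ} {n : ℕ}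
    (hX : IsSmoothProjective n X.X) {B : AbelianVariety ℂ} {k : ℕ} (hB : IsSmoothProjective k B.X) (hBs : B.IsSimple)
    {K : Type} [Field K] [NumberField K] [IsTotallyReal K] [Algebra K B.endAlgebra] [IsScalarTower ℚ K B.endAlgebra]
    [IsQuaternionAlgebra K B.endAlgebra] (hBK : B.dim = 2 * Module.finrank ℚ K) {m : ℕ} (hXB : IsIsogenous X (B.powSucc m)) :
    haveI := BettiUniverse.finite hX 1
    (BettiUniverse.hodge exists_isReal_hodgeModel_holds hX 1).mtRank = 3 * Module.finrank ℚ K + 1 := by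
  have hB0 : 0 < B.dim := by
    rw [hBK]
    have := Module.finrank_pos (R := ℚ) (M := K)
    omega
  have h := mtRank_hodge_one_eq_of_isIsogenous_powSucc hX hB hB0 hXB
  rw [h]
  exact (mtRank_hodge_one_of_isSimple_quaternion_of_dim_eq hB hBs hBK).1

/-! ## §3 The atlas rows II(3) and «III(3), `m = 1`»: sixfolds with quaternion multiplication over a totally real cubic field -/

/-- **A simple abelian SIXFOLD whose endomorphism algebra is a quaternion algebra over a totally real CUBIC field has
`dim MT(H¹B) = 10`, and `Lie Hg(H¹B) = C(End_Hdg(H¹B)) ∩ 𝔰𝔭(H¹B, ψ)` for every polarization** (the rung `t = 3e + 1` at `e = 3`;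
the algebra is automatically totally indefinite). [cite: BanaszakGajdaKrason2006, (7.22) and Thm. 7.34]
[cite: MoonenZarhin1999LowDim, (2.2)] [cite: Murty1988, Thm. 2 (p. 67)] [cite: Shimura1963AnalyticFamilies, §4] -/
theorem mtRank_hodge_one_of_isSimple_quaternion_sixfold_cubic {B : AbelianVariety ℂ} {k : ℕ} (hB : IsSmoothProjective k B.X)
    (hBs : B.IsSimple) (hB6 : B.dim = 6) {K : Type} [Field K] [NumberField K] [IsTotallyReal K] [Algebra K B.endAlgebra]
    [IsScalarTower ℚ K B.endAlgebra] [IsQuaternionAlgebra K B.endAlgebra] (hK3 : Module.finrank ℚ K = 3)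
    [Module.Finite ℚ (bettiCohomology B.X 1)] (ψ : (BettiUniverse.hodge exists_isReal_hodgeModel_holds hB 1).Polarization) :
    (BettiUniverse.hodge exists_isReal_hodgeModel_holds hB 1).mtRank = 10 ∧
      (BettiUniverse.hodge exists_isReal_hodgeModel_holds hB 1).hodgeLie = Subalgebra.toSubmodule (Subalgebra.centralizer ℚ
          ((BettiUniverse.hodge exists_isReal_hodgeModel_holds hB 1).endAlg : Set (Module.End ℚ (bettiCohomology B.X 1)))) ⊓
        ψ.form.skewAdjointSubmodule := by
  have hBK : B.dim = 2 * Module.finrank ℚ K := by rw [hB6, hK3]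
  have h1 := (mtRank_hodge_one_of_isSimple_quaternion_of_dim_eq hB hBs hBK).1
  rw [hK3] at h1
  exact ⟨h1, hodgeLie_hodge_one_eq_lefschetz_of_isSimple_quaternion_of_dim_eq hB hBs hBK ψ⟩

end Summit.HodgeConjecture.CorCM

end
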